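import Literature.MeasureTheory.Group.InvariantQuotientOrbitalProd                  -- ★ Gelbart (10.19) up to a constant: `exists_integral_descConj_eq_smul_mul`
import Literature.NumberTheory.Automorphic.OrbitalMeasureCanonicalAtPoint            -- ★ D-S1g `IsCanonical.classOrbitalIntegral_mk_eq_orbitalIntegral'`
import Literature.NumberTheory.Automorphic.OrbitalMeasureCanonicalExists             -- ★ `compactCore_prod`
import Literature.MeasureTheory.Group.InvariantQuotientCompactSubgroup               -- ★ `quotientMeasure_eq_inv_smul_map_mk` (compact subgroup)
import Literature.MeasureTheory.Group.InvariantQuotientNormalized                    -- ★ instance `smulInvariantMeasure_quotientMeasure'`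
import Literature.NumberTheory.Automorphic.ClosedCompactDecomposition                -- ★ `isInvInvariant_of_compactSpace`
import HarnessLib

/-!
# Canonical orbital integrals on `G₁ × A` with `A` COMPACT: `Φ(⟦(γ₁, a)⟧, f ∘ pr₁; m) = Φ(⟦γ₁⟧, f; m₁)` at an ELLIPTIC `γ₁`, and `= c · Φ(⟦γ₁⟧, f; m₁)` in general
(Gelbart 1975 (10.19); Rogawski 1990 §4.3 (4.3.1), §4.9 p. 54: `H = U(2) × U(1)` at a non-split place, `U(1)(F_v) = E_w¹` compact)

Topic `NumberTheory/Automorphic`; namespace `Literature.NumberTheory.Automorphic`.  THEOREMS ONLY (no definition, no instance, no notation, no named fact, no `sorry`).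
Cell `pub/hodgecm-mathlib`, programme P3a, line «N6nsGerm» (crux H413 = stmt-HodgeConjecture-24833), brick «PAIR for CANONICAL families» = FILE A of the `hI′` (B6) payer junction
(LEAD F0P3a-plan (g9) T8-88 (2); B-p08 (g27); census `B-provers/B-p08/g27/CENSUS-B6-CompactSideJunction.B-p08g27.md` §3).  HC_CM is proved only modulo the printed citations
until rung 0 closes; this file is measure bookkeeping and discharges no printed statement.

THE MATHEMATICS.  `G₁` locally compact second countable Hausdorff, `A` a COMPACT such group, `ν₁` a Haar measure on `G₁`, `ν_A` the Haar PROBABILITY on `A`, `m` an orbital-measure family on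
`G₁ × A` CANONICAL for `(P, ν₁ ⊗ ν_A)` and `m₁` one on `G₁` canonical for `(P₁, ν₁)` (★ `OrbitalMeasureFamily.IsCanonical`: the member at a pinned class is `dν ∕ dt`, `t` THE Haar measure on
the centraliser with mass one on its compact core).
* ELLIPTIC `γ₁` (compact centraliser), §2: every centraliser in sight is compact, so `dν ∕ dt = π_* ν` (★ `quotientMeasure_eq_inv_smul_map_mk`, `t` of mass one) and
  `Φ(⟦(γ₁, a)⟧, f ∘ pr₁; m) = ∫_{G₁ × A} f(g γ₁′ g⁻¹) d(ν₁ ⊗ ν_A) = ν_A(A) · ∫_{G₁} f(g γ₁ g⁻¹) dν₁ = Φ(⟦γ₁⟧, f; m₁)` (Fubini for a function of the first variable, right invariance of `ν₁`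
  to move between the representatives `γ₁′ ~ γ₁`) — EXACT, no commutativity of `A`.
* ANY pinned class, §3: Gelbart's factorisation up to a constant (★ `exists_integral_descConj_eq_smul_mul` at `e = id`, second factor the point-mass orbital integral of `𝟙` on the compact
  `A ⧸ C(a′)`, `= 1`) gives ONE `c ≠ 0` with `Φ(⟦(γ₁, a)⟧, f ∘ pr₁; m) = c · Φ(⟦γ₁⟧, f; m₁)` for every `f` (no integrability needed) — enough to transport VANISHING.

* §1 `isCompact_centralizer_of_isConj`, `compactSpace_centralizer_prod_of_compactSpace` (plumbing); §2 **`OrbitalMeasureFamily.IsCanonical.classOrbitalIntegral_comp_fst_eq_of_compactSpace`**;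
  §3 **`OrbitalMeasureFamily.IsCanonical.exists_classOrbitalIntegral_comp_fst_eq_smul`**.

References: [Gelbart1975] S. Gelbart, *Automorphic Forms on Adele Groups*, Ann. of Math. Stud. 83, p. 155 (10.19) · [Rogawski1990] J. D. Rogawski, *Automorphic Representations of
Unitary Groups in Three Variables*, Ann. of Math. Stud. 123, §4.3 (4.3.1) p. 43, §4.9 p. 54 · [Folland1995] G. B. Folland, *A Course in Abstract Harmonic Analysis*, §2.6 Thm. 2.49,
(2.52) · [DeitmarEchterhoff2014] A. Deitmar, S. Echterhoff, *Principles of Harmonic Analysis*, 2nd ed., Thm. 1.5.3, Cor. 1.5.4.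
-/

set_option autoImplicit false

noncomputable section

open MeasureTheory Measure Set Filter Topology
open scoped ENNReal NNReal
open Literature.MeasureTheory.Group

namespace Literature.NumberTheory.Automorphic

/-! ## §1 Plumbing: compact centralisers under conjugation and products -/

section Plumbing

variable {G : Type*} [Group G] [TopologicalSpace G] [IsTopologicalGroup G]

omit [TopologicalSpace G] [IsTopologicalGroup G] in
/-- The centraliser of a conjugate `x g x⁻¹` is the conjugate of the centraliser (as a set: the image under `h ↦ x h x⁻¹`). [cite: BourbakiGT1, Ch. III §2] -/
theorem coe_centralizer_conj_eq_image (g x : G) :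
    ((Subgroup.centralizer ({x * g * x⁻¹} : Set G) : Subgroup G) : Set G) = (fun h => x * h * x⁻¹) '' (Subgroup.centralizer ({g} : Set G) : Set G) := by
  ext h
  simp only [SetLike.mem_coe, Subgroup.mem_centralizer_singleton_iff, Set.mem_image]
  constructor
  · intro hh
    refine ⟨x⁻¹ * h * x, ?_, by group⟩
    calc x⁻¹ * h * x * g = x⁻¹ * (h * (x * g * x⁻¹)) * x := by group
      _ = x⁻¹ * ((x * g * x⁻¹) * h) * x := by rw [hh]
      _ = g * (x⁻¹ * h * x) := by group
  · rintro ⟨k, hk, rfl⟩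
    calc x * k * x⁻¹ * (x * g * x⁻¹) = x * (k * g) * x⁻¹ := by group
      _ = x * (g * k) * x⁻¹ := by rw [hk]
      _ = x * g * x⁻¹ * (x * k * x⁻¹) := by group

/-- **Compact centralisers are stable under conjugacy**: if `C(g)` is compact and `g′` is conjugate to `g` then `C(g′)` is compact. [cite: BourbakiGT1, Ch. III §2] -/
theorem isCompact_centralizer_of_isConj {g g' : G} (h : IsConj g g') (hg : IsCompact ((Subgroup.centralizer ({g} : Set G) : Subgroup G) : Set G)) :
    IsCompact ((Subgroup.centralizer ({g'} : Set G) : Subgroup G) : Set G) := by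
  obtain ⟨x, hx⟩ := isConj_iff.1 h
  rw [← hx, coe_centralizer_conj_eq_image]
  exact hg.image (by fun_prop)

/-- `CompactSpace` dress of ★ `isCompact_centralizer_of_isConj`. [cite: BourbakiGT1, Ch. III §2] -/
theorem compactSpace_centralizer_of_isConj {g g' : G} (h : IsConj g g') [hg : CompactSpace (Subgroup.centralizer ({g} : Set G))] :
    CompactSpace (Subgroup.centralizer ({g'} : Set G)) :=
  isCompact_iff_compactSpace.1 (isCompact_centralizer_of_isConj h (isCompact_iff_compactSpace.2 hg))

/-- In `G₁ × A` with `A` compact: if `C(γ₁)` is compact then so is `C((γ₁, a))` (`= C(γ₁) × C(a)`, `C(a)` closed in the compact `A`). [cite: BourbakiGT1, Ch. III §2] -/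
theorem compactSpace_centralizer_prod_of_compactSpace {G₁ A : Type*} [Group G₁] [Group A] [TopologicalSpace G₁] [TopologicalSpace A]
    [IsTopologicalGroup A] [CompactSpace A] [T2Space A] (γ₁ : G₁) (a : A) [h₁ : CompactSpace (Subgroup.centralizer ({γ₁} : Set G₁))] :
    CompactSpace (Subgroup.centralizer ({(γ₁, a)} : Set (G₁ × A))) := by
  have hset : ((Subgroup.centralizer ({(γ₁, a)} : Set (G₁ × A)) : Subgroup (G₁ × A)) : Set (G₁ × A)) =
      ((Subgroup.centralizer ({γ₁} : Set G₁) : Subgroup G₁) : Set G₁) ×ˢ ((Subgroup.centralizer ({a} : Set A) : Subgroup A) : Set A) := by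
    rw [centralizer_singleton_prod_eq]; rfl
  refine isCompact_iff_compactSpace.1 ?_
  rw [hset]
  exact (isCompact_iff_compactSpace.2 h₁).prod (isClosed_coe_centralizer_singleton a).isCompact

end Plumbing

/-! ## §2 The elliptic case: exact pairing -/

section CompactFactor

variable {G₁ A : Type*} [Group G₁] [Group A]
  [TopologicalSpace G₁] [IsTopologicalGroup G₁] [LocallyCompactSpace G₁] [SecondCountableTopology G₁] [T2Space G₁]
  [MeasurableSpace G₁] [BorelSpace G₁]
  [TopologicalSpace A] [IsTopologicalGroup A] [CompactSpace A] [LocallyCompactSpace A] [SecondCountableTopology A] [T2Space A]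
  [MeasurableSpace A] [BorelSpace A]
  [∀ γ : G₁, MeasurableSpace (G₁ ⧸ Subgroup.centralizer ({γ} : Set G₁))]
  [∀ γ : G₁, BorelSpace (G₁ ⧸ Subgroup.centralizer ({γ} : Set G₁))]
  [∀ γ : G₁ × A, MeasurableSpace ((G₁ × A) ⧸ Subgroup.centralizer ({γ} : Set (G₁ × A)))]
  [∀ γ : G₁ × A, BorelSpace ((G₁ × A) ⧸ Subgroup.centralizer ({γ} : Set (G₁ × A)))]

/-- At a class with COMPACT centraliser a canonical member is the push-forward of Haar measure: `m c = π_* ν`. [cite: DeitmarEchterhoff2014, Cor. 1.5.4] [cite: Rogawski1990, §4.3 (4.3.1) p. 43] -/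
theorem OrbitalMeasureFamily.IsCanonical.eq_map_mk_of_compactSpace {G : Type*} [Group G] [TopologicalSpace G] [IsTopologicalGroup G] [LocallyCompactSpace G]
    [SecondCountableTopology G] [T2Space G] [MeasurableSpace G] [BorelSpace G]
    [∀ γ : G, MeasurableSpace (G ⧸ Subgroup.centralizer ({γ} : Set G))] [∀ γ : G, BorelSpace (G ⧸ Subgroup.centralizer ({γ} : Set G))]
    {P : G → Prop} {ν : Measure G} [ν.IsHaarMeasure] [ν.IsMulRightInvariant] {m : OrbitalMeasureFamily G} (hm : m.IsCanonical P ν)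
    (c : ConjClasses G) (hc : P (Quotient.out c)) [hZ : CompactSpace (Subgroup.centralizer ({(Quotient.out c : G)} : Set G))] :
    m c = Measure.map (QuotientGroup.mk : G → G ⧸ Subgroup.centralizer ({(Quotient.out c : G)} : Set G)) ν := by
  obtain ⟨t, htH, htI, htcore, hmc⟩ := hm c hc
  haveI : IsClosed ((Subgroup.centralizer ({(Quotient.out c : G)} : Set G) : Subgroup G) : Set G) := isClosed_coe_centralizer_singleton _
  have htuniv : t Set.univ = 1 := by rwa [compactCore_eq_univ] at htcore
  rw [hmc, quotientMeasure_eq_inv_smul_map_mk (Subgroup.centralizer ({(Quotient.out c : G)} : Set G)) t ν, htuniv, inv_one, one_smul]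

/-- **PAIR FOR CANONICAL FAMILIES AT AN ELLIPTIC CLASS (exact)**: on `G₁ × A` with `A` COMPACT, for `m` canonical for `(P, ν₁ ⊗ ν_A)` (`ν_A(A) = 1`) and `m₁` canonical for `(P₁, ν₁)`, at a
point `(γ₁, a)` whose classes are pinned (`P`, `P₁` at the representatives) and with `C(γ₁)` COMPACT: `Φ(⟦(γ₁, a)⟧, f ∘ pr₁; m) = Φ(⟦γ₁⟧, f; m₁)` for every continuous `f : G₁ → ℂ`.
[cite: Gelbart1975, p. 155 (10.19)] [cite: Rogawski1990, §4.3 (4.3.1) p. 43; §4.9 p. 54] [cite: Folland1995, §2.6 (2.52)] [cite: DeitmarEchterhoff2014, Cor. 1.5.4] -/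
theorem OrbitalMeasureFamily.IsCanonical.classOrbitalIntegral_comp_fst_eq_of_compactSpace
    (ν₁ : Measure G₁) [ν₁.IsHaarMeasure] [ν₁.IsMulRightInvariant]
    (νA : Measure A) [νA.IsHaarMeasure] [νA.IsMulRightInvariant] (hνA : νA Set.univ = 1)
    {P : G₁ × A → Prop} {m : OrbitalMeasureFamily (G₁ × A)} (hm : m.IsCanonical P (ν₁.prod νA))
    {P₁ : G₁ → Prop} {m₁ : OrbitalMeasureFamily G₁} (hm₁ : m₁.IsCanonical P₁ ν₁)
    (γ₁ : G₁) (a : A) (hc : P (Quotient.out (ConjClasses.mk (γ₁, a)))) (hc₁ : P₁ (Quotient.out (ConjClasses.mk γ₁)))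
    [CompactSpace (Subgroup.centralizer ({γ₁} : Set G₁))] {f : G₁ → ℂ} (hf : Continuous f) :
    classOrbitalIntegral m (fun p : G₁ × A => f p.1) (ConjClasses.mk (γ₁, a)) = classOrbitalIntegral m₁ f (ConjClasses.mk γ₁) := by
  -- representatives and compactness of their centralisers
  obtain ⟨z, hz⟩ := isConj_iff.1 (ConjClasses.mk_eq_mk_iff_isConj.1 (Quotient.out_eq (ConjClasses.mk (γ₁, a))).symm)
  obtain ⟨x, hx⟩ := isConj_iff.1 (ConjClasses.mk_eq_mk_iff_isConj.1 (Quotient.out_eq (ConjClasses.mk γ₁)).symm)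
  haveI : CompactSpace (Subgroup.centralizer ({(γ₁, a)} : Set (G₁ × A))) := compactSpace_centralizer_prod_of_compactSpace γ₁ a
  haveI : CompactSpace (Subgroup.centralizer ({(Quotient.out (ConjClasses.mk (γ₁, a)) : G₁ × A)} : Set (G₁ × A))) :=
    compactSpace_centralizer_of_isConj (isConj_iff.2 ⟨z, hz⟩)
  haveI : CompactSpace (Subgroup.centralizer ({(Quotient.out (ConjClasses.mk γ₁) : G₁)} : Set G₁)) :=
    compactSpace_centralizer_of_isConj (isConj_iff.2 ⟨x, hx⟩)
  -- both members are push-forwards of Haar measure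
  rw [classOrbitalIntegral_eq, classOrbitalIntegral_eq, hm.eq_map_mk_of_compactSpace _ hc, hm₁.eq_map_mk_of_compactSpace _ hc₁,
    orbitalIntegral_eq_integral_descConj, orbitalIntegral_eq_integral_descConj,
    integral_map QuotientGroup.continuous_mk.measurable.aemeasurable
      ((continuous_descConj _ _ _ (show Continuous (fun p : G₁ × A => f p.1) from hf.comp continuous_fst)).aestronglyMeasurable),
    integral_map QuotientGroup.continuous_mk.measurable.aemeasurable ((continuous_descConj _ _ _ hf).aestronglyMeasurable)]
  simp only [descConj_mk]
  -- the integrand depends on the first variable only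
  have h1 : (fun g : G₁ × A => f (g * Quotient.out (ConjClasses.mk (γ₁, a)) * g⁻¹).1) = fun g : G₁ × A => f (g.1 * (z.1 * γ₁ * z.1⁻¹) * g.1⁻¹) := by
    funext g
    rw [← hz]
    rfl
  rw [h1, integral_fun_fst (μ := ν₁) (ν := νA) (fun g : G₁ => f (g * (z.1 * γ₁ * z.1⁻¹) * g⁻¹)), Measure.real, hνA, ENNReal.toReal_one, one_smul, ← hx]
  -- move between the representatives `z.1 γ₁ z.1⁻¹ ~ γ₁ ~ x γ₁ x⁻¹` by right invariance of `ν₁`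
  have h2 : ∫ g : G₁, f (g * (z.1 * γ₁ * z.1⁻¹) * g⁻¹) ∂ν₁ = ∫ g : G₁, f (g * γ₁ * g⁻¹) ∂ν₁ := by
    have hfun : (fun g : G₁ => f (g * (z.1 * γ₁ * z.1⁻¹) * g⁻¹)) = fun g : G₁ => (fun g' : G₁ => f (g' * γ₁ * g'⁻¹)) (g * z.1) := by
      funext g; exact congrArg f (by group)
    rw [hfun]
    exact integral_mul_right_eq_self (fun g' : G₁ => f (g' * γ₁ * g'⁻¹)) z.1
  have h3 : ∫ g : G₁, f (g * (x * γ₁ * x⁻¹) * g⁻¹) ∂ν₁ = ∫ g : G₁, f (g * γ₁ * g⁻¹) ∂ν₁ := by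
    have hfun : (fun g : G₁ => f (g * (x * γ₁ * x⁻¹) * g⁻¹)) = fun g : G₁ => (fun g' : G₁ => f (g' * γ₁ * g'⁻¹)) (g * x) := by
      funext g; exact congrArg f (by group)
    rw [hfun]
    exact integral_mul_right_eq_self (fun g' : G₁ => f (g' * γ₁ * g'⁻¹)) x
  rw [h2, h3]

/-! ## §3 Any pinned class: pairing up to a constant -/

/-- **PAIR FOR CANONICAL FAMILIES AT ANY PINNED CLASS (up to a constant)**: on `G₁ × A` with `A` COMPACT, for `m` canonical for `(P, ν₁ ⊗ ν_A)` and `m₁` canonical for `(P₁, ν₁)`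
(`P₁` conjugation-invariant, with a canonical torus measure at every `P₁`-point), at a point `(γ₁, a)` with `P (out ⟦(γ₁, a)⟧)` and `P₁ γ₁` there is ONE `c ≠ 0` with
`Φ(⟦(γ₁, a)⟧, f ∘ pr₁; m) = c · Φ(⟦γ₁⟧, f; m₁)` for EVERY `f : G₁ → ℂ` (no integrability hypotheses — so vanishing transports).
[cite: Gelbart1975, p. 155 (10.19)] [cite: Folland1995, §2.6 Thm. 2.49] [cite: Rogawski1990, §4.3 (4.3.1) p. 43] -/
theorem OrbitalMeasureFamily.IsCanonical.exists_classOrbitalIntegral_comp_fst_eq_smul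
    (ν₁ : Measure G₁) [ν₁.IsHaarMeasure] [ν₁.IsMulRightInvariant]
    (νA : Measure A) [νA.IsHaarMeasure] [νA.IsMulRightInvariant]
    {P : G₁ × A → Prop} {m : OrbitalMeasureFamily (G₁ × A)} (hm : m.IsCanonical P (ν₁.prod νA))
    {P₁ : G₁ → Prop} (hP₁ : ∀ g x : G₁, P₁ g → P₁ (x * g * x⁻¹)) {m₁ : OrbitalMeasureFamily G₁} (hm₁ : m₁.IsCanonical P₁ ν₁)
    (ht₁ : ∀ g : G₁, P₁ g → ∃ t : Measure (Subgroup.centralizer ({g} : Set G₁)), t.IsHaarMeasure ∧ t.IsInvInvariant ∧ t (compactCore (Subgroup.centralizer ({g} : Set G₁))) = 1)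
    (γ₁ : G₁) (a : A) (hc : P (Quotient.out (ConjClasses.mk (γ₁, a)))) (hγ₁ : P₁ γ₁) :
    ∃ c : ℂ, c ≠ 0 ∧ ∀ f : G₁ → ℂ,
      classOrbitalIntegral m (fun p : G₁ × A => f p.1) (ConjClasses.mk (γ₁, a)) = c * classOrbitalIntegral m₁ f (ConjClasses.mk γ₁) := by
  -- the representative `q = out ⟦(γ₁, a)⟧ = (γ₁′, a′)`, `γ₁′ = z.1 γ₁ z.1⁻¹` (spelled out: its type indexes the member of `m`)
  obtain ⟨z, hz⟩ := isConj_iff.1 (ConjClasses.mk_eq_mk_iff_isConj.1 (Quotient.out_eq (ConjClasses.mk (γ₁, a))).symm)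
  have hq1 : (Quotient.out (ConjClasses.mk (γ₁, a)) : G₁ × A).1 = z.1 * γ₁ * z.1⁻¹ := by rw [← hz]; rfl
  have hP₁' : P₁ (Quotient.out (ConjClasses.mk (γ₁, a)) : G₁ × A).1 := by rw [hq1]; exact hP₁ γ₁ z.1 hγ₁
  have hmk₁ : ConjClasses.mk (Quotient.out (ConjClasses.mk (γ₁, a)) : G₁ × A).1 = ConjClasses.mk γ₁ := by
    rw [hq1]; exact ConjClasses.mk_eq_mk_iff_isConj.2 (isConj_iff.2 ⟨z.1, rfl⟩).symm
  -- the member of `m` at the class: invariant, non-zero, finite on compact sets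
  obtain ⟨hne, hinv, hfin⟩ := hm.isAdmissibleOn _ hc
  haveI := hinv
  haveI := hfin
  -- the canonical torus measure at `γ₁′` and its quotient measure
  obtain ⟨t, htH, htI, htcore⟩ := ht₁ _ hP₁'
  haveI := htH
  haveI := htI
  have hC₁ : IsClosed ((Subgroup.centralizer ({(Quotient.out (ConjClasses.mk (γ₁, a)) : G₁ × A).1} : Set G₁) : Subgroup G₁) : Set G₁) :=
    isClosed_coe_centralizer_singleton _
  haveI : LocallyCompactSpace (Subgroup.centralizer ({(Quotient.out (ConjClasses.mk (γ₁, a)) : G₁ × A).1} : Set G₁)) :=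
    hC₁.isClosedEmbedding_subtypeVal.locallyCompactSpace
  -- the compact `C(a′)` with its Haar probability and the quotient `A ⧸ C(a′)`
  have hC₂ : IsClosed ((Subgroup.centralizer ({(Quotient.out (ConjClasses.mk (γ₁, a)) : G₁ × A).2} : Set A) : Subgroup A) : Set A) :=
    isClosed_coe_centralizer_singleton _
  haveI : CompactSpace (Subgroup.centralizer ({(Quotient.out (ConjClasses.mk (γ₁, a)) : G₁ × A).2} : Set A)) := isCompact_iff_compactSpace.1 hC₂.isCompact
  letI : MeasurableSpace (A ⧸ Subgroup.centralizer ({(Quotient.out (ConjClasses.mk (γ₁, a)) : G₁ × A).2} : Set A)) := borel _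
  haveI : BorelSpace (A ⧸ Subgroup.centralizer ({(Quotient.out (ConjClasses.mk (γ₁, a)) : G₁ × A).2} : Set A)) := ⟨rfl⟩
  obtain ⟨t₂, ht₂H, ht₂univ⟩ : ∃ t₂ : Measure (Subgroup.centralizer ({(Quotient.out (ConjClasses.mk (γ₁, a)) : G₁ × A).2} : Set A)),
      t₂.IsHaarMeasure ∧ t₂ Set.univ = 1 := by
    have h0 : (Measure.haar : Measure (Subgroup.centralizer ({(Quotient.out (ConjClasses.mk (γ₁, a)) : G₁ × A).2} : Set A))) Set.univ ≠ 0 :=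
      isOpen_univ.measure_ne_zero _ univ_nonempty
    have htop : (Measure.haar : Measure (Subgroup.centralizer ({(Quotient.out (ConjClasses.mk (γ₁, a)) : G₁ × A).2} : Set A))) Set.univ ≠ ∞ := measure_ne_top _ _
    refine ⟨((Measure.haar : Measure (Subgroup.centralizer ({(Quotient.out (ConjClasses.mk (γ₁, a)) : G₁ × A).2} : Set A))) Set.univ)⁻¹ • Measure.haar, ?_, ?_⟩
    · exact IsHaarMeasure.smul _ (ENNReal.inv_ne_zero.2 htop) (ENNReal.inv_ne_top.2 h0)
    · rw [Measure.smul_apply, smul_eq_mul, ENNReal.inv_mul_cancel h0 htop]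
  haveI := ht₂H
  haveI : t₂.IsInvInvariant := isInvInvariant_of_compactSpace t₂
  haveI : IsClosed ((Subgroup.centralizer ({(Quotient.out (ConjClasses.mk (γ₁, a)) : G₁ × A).2} : Set A) : Subgroup A) : Set A) := hC₂
  have huniv₂ : quotientMeasure (Subgroup.centralizer ({(Quotient.out (ConjClasses.mk (γ₁, a)) : G₁ × A).2} : Set A)) t₂ hC₂ νA Set.univ = νA Set.univ := by
    rw [quotientMeasure_eq_inv_smul_map_mk (Subgroup.centralizer ({(Quotient.out (ConjClasses.mk (γ₁, a)) : G₁ × A).2} : Set A)) t₂ νA, Measure.smul_apply,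
      smul_eq_mul, Measure.map_apply QuotientGroup.continuous_mk.measurable MeasurableSet.univ, Set.preimage_univ, ht₂univ, inv_one, one_mul]
  haveI : IsFiniteMeasure (quotientMeasure (Subgroup.centralizer ({(Quotient.out (ConjClasses.mk (γ₁, a)) : G₁ × A).2} : Set A)) t₂ hC₂ νA) :=
    ⟨by rw [huniv₂]; exact measure_lt_top _ _⟩
  -- Gelbart's factorisation up to a constant, at `e = id`
  have he : Continuous (MulEquiv.refl (G₁ × A)) := continuous_id
  have hes : Continuous (MulEquiv.refl (G₁ × A)).symm := continuous_id
  have hqe : (MulEquiv.refl (G₁ × A)) ((Quotient.out (ConjClasses.mk (γ₁, a)) : G₁ × A).1, (Quotient.out (ConjClasses.mk (γ₁, a)) : G₁ × A).2) =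
      Quotient.out (ConjClasses.mk (γ₁, a)) := rfl
  obtain ⟨c, hc0, hfac⟩ := exists_integral_descConj_eq_smul_mul (MulEquiv.refl (G₁ × A)) he hes hqe hC₁ hC₂ (m (ConjClasses.mk (γ₁, a)))
    (quotientMeasure (Subgroup.centralizer ({(Quotient.out (ConjClasses.mk (γ₁, a)) : G₁ × A).1} : Set G₁)) t hC₁ ν₁)
    (quotientMeasure (Subgroup.centralizer ({(Quotient.out (ConjClasses.mk (γ₁, a)) : G₁ × A).2} : Set A)) t₂ hC₂ νA)
    hne (quotientMeasure_ne_zero _ _ _ _) (quotientMeasure_ne_zero _ _ _ _)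
  -- the `A`-factor: the orbital integral of `𝟙` over `A ⧸ C(a′)`
  have hone : ∫ x, descConj (Quotient.out (ConjClasses.mk (γ₁, a)) : G₁ × A).2
      (Subgroup.centralizer ({(Quotient.out (ConjClasses.mk (γ₁, a)) : G₁ × A).2} : Set A))
      (centralizer_comm (Quotient.out (ConjClasses.mk (γ₁, a)) : G₁ × A).2) (fun _ : A => (1 : ℂ)) x
      ∂quotientMeasure (Subgroup.centralizer ({(Quotient.out (ConjClasses.mk (γ₁, a)) : G₁ × A).2} : Set A)) t₂ hC₂ νA = (νA.real Set.univ : ℂ) := by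
    have h1 : descConj (Quotient.out (ConjClasses.mk (γ₁, a)) : G₁ × A).2 (Subgroup.centralizer ({(Quotient.out (ConjClasses.mk (γ₁, a)) : G₁ × A).2} : Set A))
        (centralizer_comm (Quotient.out (ConjClasses.mk (γ₁, a)) : G₁ × A).2) (fun _ : A => (1 : ℂ)) = fun _ => (1 : ℂ) := by
      funext x
      induction x using QuotientGroup.induction_on with
      | H k => rfl
    rw [h1, integral_const, Measure.real, huniv₂, Complex.real_smul, mul_one, Measure.real]
  have hνA0 : νA.real Set.univ ≠ 0 := by
    rw [Measure.real, ENNReal.toReal_ne_zero]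
    exact ⟨isOpen_univ.measure_ne_zero νA univ_nonempty, measure_ne_top νA _⟩
  refine ⟨((c : ℝ) : ℂ) * (νA.real Set.univ : ℂ),
    mul_ne_zero (Complex.ofReal_ne_zero.2 (NNReal.coe_ne_zero.2 hc0)) (Complex.ofReal_ne_zero.2 hνA0), fun f => ?_⟩
  have hf := hfac (fun p : G₁ × A => f p.1) f (fun _ => (1 : ℂ)) (fun _ _ => by simp only [MulEquiv.refl_apply, mul_one])
  rw [hone] at hf
  rw [classOrbitalIntegral_eq, orbitalIntegral_eq_integral_descConj, ← hmk₁,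
    hm₁.classOrbitalIntegral_mk_eq_orbitalIntegral' hP₁ hP₁' t htcore f, orbitalIntegral_eq_integral_descConj]
  refine hf.trans ?_
  rw [NNReal.smul_def, Complex.real_smul]
  ring

end CompactFactor

/-! ## §4 (ED. 2) The two heads for an ARBITRARY Haar `ν` on `G₁ × A` (`G₁`-side measure `(pr₁)_* ν`, resp. any Haar measure) — the CM consumer's form -/

section CompactFactorGeneral

variable {G₁ A : Type*} [Group G₁] [Group A]
  [TopologicalSpace G₁] [IsTopologicalGroup G₁] [LocallyCompactSpace G₁] [SecondCountableTopology G₁] [T2Space G₁]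
  [MeasurableSpace G₁] [BorelSpace G₁]
  [TopologicalSpace A] [IsTopologicalGroup A] [CompactSpace A] [LocallyCompactSpace A] [SecondCountableTopology A] [T2Space A]
  [MeasurableSpace A] [BorelSpace A]
  [∀ γ : G₁, MeasurableSpace (G₁ ⧸ Subgroup.centralizer ({γ} : Set G₁))]
  [∀ γ : G₁, BorelSpace (G₁ ⧸ Subgroup.centralizer ({γ} : Set G₁))]
  [∀ γ : G₁ × A, MeasurableSpace ((G₁ × A) ⧸ Subgroup.centralizer ({γ} : Set (G₁ × A)))]
  [∀ γ : G₁ × A, BorelSpace ((G₁ × A) ⧸ Subgroup.centralizer ({γ} : Set (G₁ × A)))]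

/-- **PAIR AT AN ELLIPTIC CLASS, arbitrary Haar `ν` on `G₁ × A`**: for `m` canonical for `(P, ν)` and `m₁` canonical for `(P₁, ν₁)` with `(pr₁)_* ν = ν₁`, at a point `(γ₁, a)` with pinned
classes and `C(γ₁)` compact: `Φ(⟦(γ₁, a)⟧, f ∘ pr₁; m) = Φ(⟦γ₁⟧, f; m₁)` for continuous `f`. [cite: Gelbart1975, p. 155 (10.19)] [cite: Rogawski1990, §4.3 (4.3.1) p. 43; §4.9 p. 54]
[cite: DeitmarEchterhoff2014, Cor. 1.5.4] -/
theorem OrbitalMeasureFamily.IsCanonical.classOrbitalIntegral_comp_fst_eq_of_compactSpace_of_map_fst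
    (ν : Measure (G₁ × A)) [ν.IsHaarMeasure] [ν.IsMulRightInvariant]
    {P : G₁ × A → Prop} {m : OrbitalMeasureFamily (G₁ × A)} (hm : m.IsCanonical P ν)
    (ν₁ : Measure G₁) [ν₁.IsHaarMeasure] [ν₁.IsMulRightInvariant] (hν₁ : Measure.map Prod.fst ν = ν₁)
    {P₁ : G₁ → Prop} {m₁ : OrbitalMeasureFamily G₁} (hm₁ : m₁.IsCanonical P₁ ν₁)
    (γ₁ : G₁) (a : A) (hc : P (Quotient.out (ConjClasses.mk (γ₁, a)))) (hc₁ : P₁ (Quotient.out (ConjClasses.mk γ₁)))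
    [CompactSpace (Subgroup.centralizer ({γ₁} : Set G₁))] {f : G₁ → ℂ} (hf : Continuous f) :
    classOrbitalIntegral m (fun p : G₁ × A => f p.1) (ConjClasses.mk (γ₁, a)) = classOrbitalIntegral m₁ f (ConjClasses.mk γ₁) := by
  obtain ⟨z, hz⟩ := isConj_iff.1 (ConjClasses.mk_eq_mk_iff_isConj.1 (Quotient.out_eq (ConjClasses.mk (γ₁, a))).symm)
  obtain ⟨x, hx⟩ := isConj_iff.1 (ConjClasses.mk_eq_mk_iff_isConj.1 (Quotient.out_eq (ConjClasses.mk γ₁)).symm)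
  haveI : CompactSpace (Subgroup.centralizer ({(γ₁, a)} : Set (G₁ × A))) := compactSpace_centralizer_prod_of_compactSpace γ₁ a
  haveI : CompactSpace (Subgroup.centralizer ({(Quotient.out (ConjClasses.mk (γ₁, a)) : G₁ × A)} : Set (G₁ × A))) :=
    compactSpace_centralizer_of_isConj (isConj_iff.2 ⟨z, hz⟩)
  haveI : CompactSpace (Subgroup.centralizer ({(Quotient.out (ConjClasses.mk γ₁) : G₁)} : Set G₁)) :=
    compactSpace_centralizer_of_isConj (isConj_iff.2 ⟨x, hx⟩)
  rw [classOrbitalIntegral_eq, classOrbitalIntegral_eq, hm.eq_map_mk_of_compactSpace _ hc, hm₁.eq_map_mk_of_compactSpace _ hc₁,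
    orbitalIntegral_eq_integral_descConj, orbitalIntegral_eq_integral_descConj,
    integral_map QuotientGroup.continuous_mk.measurable.aemeasurable
      ((continuous_descConj _ _ _ (show Continuous (fun p : G₁ × A => f p.1) from hf.comp continuous_fst)).aestronglyMeasurable),
    integral_map QuotientGroup.continuous_mk.measurable.aemeasurable ((continuous_descConj _ _ _ hf).aestronglyMeasurable)]
  simp only [descConj_mk]
  have h1 : (fun g : G₁ × A => f (g * Quotient.out (ConjClasses.mk (γ₁, a)) * g⁻¹).1) =
      fun g : G₁ × A => (fun y : G₁ => f (y * (z.1 * γ₁ * z.1⁻¹) * y⁻¹)) g.1 := by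
    funext g
    rw [← hz]
    rfl
  have hF : Continuous (fun y : G₁ => f (y * (z.1 * γ₁ * z.1⁻¹) * y⁻¹)) := by fun_prop
  rw [h1, ← integral_map measurable_fst.aemeasurable hF.aestronglyMeasurable, hν₁, ← hx]
  have h2 : ∫ g : G₁, f (g * (z.1 * γ₁ * z.1⁻¹) * g⁻¹) ∂ν₁ = ∫ g : G₁, f (g * γ₁ * g⁻¹) ∂ν₁ := by
    have hfun : (fun g : G₁ => f (g * (z.1 * γ₁ * z.1⁻¹) * g⁻¹)) = fun g : G₁ => (fun g' : G₁ => f (g' * γ₁ * g'⁻¹)) (g * z.1) := by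
      funext g; exact congrArg f (by group)
    rw [hfun]
    exact integral_mul_right_eq_self (fun g' : G₁ => f (g' * γ₁ * g'⁻¹)) z.1
  have h3 : ∫ g : G₁, f (g * (x * γ₁ * x⁻¹) * g⁻¹) ∂ν₁ = ∫ g : G₁, f (g * γ₁ * g⁻¹) ∂ν₁ := by
    have hfun : (fun g : G₁ => f (g * (x * γ₁ * x⁻¹) * g⁻¹)) = fun g : G₁ => (fun g' : G₁ => f (g' * γ₁ * g'⁻¹)) (g * x) := by
      funext g; exact congrArg f (by group)
    rw [hfun]
    exact integral_mul_right_eq_self (fun g' : G₁ => f (g' * γ₁ * g'⁻¹)) x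
  rw [h2, h3]

/-- **PAIR AT ANY PINNED CLASS up to a constant, arbitrary Haar `ν` on `G₁ × A` and arbitrary Haar `ν₁` on `G₁`**: for `m` canonical for `(P, ν)`, `m₁` canonical for `(P₁, ν₁)`
(`P₁` conjugation-invariant with canonical torus measures at `P₁`-points), at `(γ₁, a)` with `P (out ⟦(γ₁, a)⟧)` and `P₁ γ₁`: ONE `c ≠ 0` with
`Φ(⟦(γ₁, a)⟧, f ∘ pr₁; m) = c · Φ(⟦γ₁⟧, f; m₁)` for every `f` (no integrability needed). [cite: Gelbart1975, p. 155 (10.19)] [cite: Folland1995, §2.6 Thm. 2.49]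
[cite: Rogawski1990, §4.3 (4.3.1) p. 43] -/
theorem OrbitalMeasureFamily.IsCanonical.exists_classOrbitalIntegral_comp_fst_eq_smul_of_haar
    (ν : Measure (G₁ × A)) [ν.IsHaarMeasure] [ν.IsMulRightInvariant]
    {P : G₁ × A → Prop} {m : OrbitalMeasureFamily (G₁ × A)} (hm : m.IsCanonical P ν)
    (ν₁ : Measure G₁) [ν₁.IsHaarMeasure] [ν₁.IsMulRightInvariant]
    {P₁ : G₁ → Prop} (hP₁ : ∀ g x : G₁, P₁ g → P₁ (x * g * x⁻¹)) {m₁ : OrbitalMeasureFamily G₁} (hm₁ : m₁.IsCanonical P₁ ν₁)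
    (ht₁ : ∀ g : G₁, P₁ g → ∃ t : Measure (Subgroup.centralizer ({g} : Set G₁)), t.IsHaarMeasure ∧ t.IsInvInvariant ∧ t (compactCore (Subgroup.centralizer ({g} : Set G₁))) = 1)
    (γ₁ : G₁) (a : A) (hc : P (Quotient.out (ConjClasses.mk (γ₁, a)))) (hγ₁ : P₁ γ₁) :
    ∃ c : ℂ, c ≠ 0 ∧ ∀ f : G₁ → ℂ,
      classOrbitalIntegral m (fun p : G₁ × A => f p.1) (ConjClasses.mk (γ₁, a)) = c * classOrbitalIntegral m₁ f (ConjClasses.mk γ₁) := by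
  -- a Haar probability on the compact `A`
  obtain ⟨νA, hνAH, hνA⟩ : ∃ νA : Measure A, νA.IsHaarMeasure ∧ νA Set.univ = 1 := by
    have h0 : (Measure.haar : Measure A) Set.univ ≠ 0 := isOpen_univ.measure_ne_zero _ univ_nonempty
    have htop : (Measure.haar : Measure A) Set.univ ≠ ∞ := measure_ne_top _ _
    refine ⟨((Measure.haar : Measure A) Set.univ)⁻¹ • Measure.haar, ?_, ?_⟩
    · exact IsHaarMeasure.smul _ (ENNReal.inv_ne_zero.2 htop) (ENNReal.inv_ne_top.2 h0)
    · rw [Measure.smul_apply, smul_eq_mul, ENNReal.inv_mul_cancel h0 htop]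
  haveI := hνAH; haveI : νA.IsMulRightInvariant := isMulRightInvariant_of_compactSpace νA
  -- the representative `q = out ⟦(γ₁, a)⟧`, `q.1 = z.1 γ₁ z.1⁻¹`
  obtain ⟨z, hz⟩ := isConj_iff.1 (ConjClasses.mk_eq_mk_iff_isConj.1 (Quotient.out_eq (ConjClasses.mk (γ₁, a))).symm)
  have hq1 : (Quotient.out (ConjClasses.mk (γ₁, a)) : G₁ × A).1 = z.1 * γ₁ * z.1⁻¹ := by rw [← hz]; rfl
  have hP₁' : P₁ (Quotient.out (ConjClasses.mk (γ₁, a)) : G₁ × A).1 := by rw [hq1]; exact hP₁ γ₁ z.1 hγ₁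
  have hmk₁ : ConjClasses.mk (Quotient.out (ConjClasses.mk (γ₁, a)) : G₁ × A).1 = ConjClasses.mk γ₁ := by
    rw [hq1]; exact ConjClasses.mk_eq_mk_iff_isConj.2 (isConj_iff.2 ⟨z.1, rfl⟩).symm
  obtain ⟨hne, hinv, hfin⟩ := hm.isAdmissibleOn _ hc
  haveI := hinv; haveI := hfin
  obtain ⟨t, htH, htI, htcore⟩ := ht₁ _ hP₁'
  haveI := htH; haveI := htI
  have hC₁ : IsClosed ((Subgroup.centralizer ({(Quotient.out (ConjClasses.mk (γ₁, a)) : G₁ × A).1} : Set G₁) : Subgroup G₁) : Set G₁) :=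
    isClosed_coe_centralizer_singleton _
  haveI : LocallyCompactSpace (Subgroup.centralizer ({(Quotient.out (ConjClasses.mk (γ₁, a)) : G₁ × A).1} : Set G₁)) :=
    hC₁.isClosedEmbedding_subtypeVal.locallyCompactSpace
  have hC₂ : IsClosed ((Subgroup.centralizer ({(Quotient.out (ConjClasses.mk (γ₁, a)) : G₁ × A).2} : Set A) : Subgroup A) : Set A) :=
    isClosed_coe_centralizer_singleton _
  haveI : CompactSpace (Subgroup.centralizer ({(Quotient.out (ConjClasses.mk (γ₁, a)) : G₁ × A).2} : Set A)) := isCompact_iff_compactSpace.1 hC₂.isCompact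
  letI : MeasurableSpace (A ⧸ Subgroup.centralizer ({(Quotient.out (ConjClasses.mk (γ₁, a)) : G₁ × A).2} : Set A)) := borel _
  haveI : BorelSpace (A ⧸ Subgroup.centralizer ({(Quotient.out (ConjClasses.mk (γ₁, a)) : G₁ × A).2} : Set A)) := ⟨rfl⟩
  obtain ⟨t₂, ht₂H, ht₂univ⟩ : ∃ t₂ : Measure (Subgroup.centralizer ({(Quotient.out (ConjClasses.mk (γ₁, a)) : G₁ × A).2} : Set A)),
      t₂.IsHaarMeasure ∧ t₂ Set.univ = 1 := by
    have h0 : (Measure.haar : Measure (Subgroup.centralizer ({(Quotient.out (ConjClasses.mk (γ₁, a)) : G₁ × A).2} : Set A))) Set.univ ≠ 0 :=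
      isOpen_univ.measure_ne_zero _ univ_nonempty
    have htop : (Measure.haar : Measure (Subgroup.centralizer ({(Quotient.out (ConjClasses.mk (γ₁, a)) : G₁ × A).2} : Set A))) Set.univ ≠ ∞ := measure_ne_top _ _
    refine ⟨((Measure.haar : Measure (Subgroup.centralizer ({(Quotient.out (ConjClasses.mk (γ₁, a)) : G₁ × A).2} : Set A))) Set.univ)⁻¹ • Measure.haar, ?_, ?_⟩
    · exact IsHaarMeasure.smul _ (ENNReal.inv_ne_zero.2 htop) (ENNReal.inv_ne_top.2 h0)
    · rw [Measure.smul_apply, smul_eq_mul, ENNReal.inv_mul_cancel h0 htop]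
  haveI := ht₂H; haveI : t₂.IsInvInvariant := isInvInvariant_of_compactSpace t₂
  haveI : IsClosed ((Subgroup.centralizer ({(Quotient.out (ConjClasses.mk (γ₁, a)) : G₁ × A).2} : Set A) : Subgroup A) : Set A) := hC₂
  have huniv₂ : quotientMeasure (Subgroup.centralizer ({(Quotient.out (ConjClasses.mk (γ₁, a)) : G₁ × A).2} : Set A)) t₂ hC₂ νA Set.univ = 1 := by
    rw [quotientMeasure_eq_inv_smul_map_mk (Subgroup.centralizer ({(Quotient.out (ConjClasses.mk (γ₁, a)) : G₁ × A).2} : Set A)) t₂ νA, Measure.smul_apply,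
      smul_eq_mul, Measure.map_apply QuotientGroup.continuous_mk.measurable MeasurableSet.univ, Set.preimage_univ, ht₂univ, hνA, inv_one, one_mul]
  haveI : IsFiniteMeasure (quotientMeasure (Subgroup.centralizer ({(Quotient.out (ConjClasses.mk (γ₁, a)) : G₁ × A).2} : Set A)) t₂ hC₂ νA) :=
    ⟨by rw [huniv₂]; exact ENNReal.one_lt_top⟩
  have he : Continuous (MulEquiv.refl (G₁ × A)) := continuous_id
  have hes : Continuous (MulEquiv.refl (G₁ × A)).symm := continuous_id
  have hqe : (MulEquiv.refl (G₁ × A)) ((Quotient.out (ConjClasses.mk (γ₁, a)) : G₁ × A).1, (Quotient.out (ConjClasses.mk (γ₁, a)) : G₁ × A).2) =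
      Quotient.out (ConjClasses.mk (γ₁, a)) := rfl
  obtain ⟨c, hc0, hfac⟩ := exists_integral_descConj_eq_smul_mul (MulEquiv.refl (G₁ × A)) he hes hqe hC₁ hC₂ (m (ConjClasses.mk (γ₁, a)))
    (quotientMeasure (Subgroup.centralizer ({(Quotient.out (ConjClasses.mk (γ₁, a)) : G₁ × A).1} : Set G₁)) t hC₁ ν₁)
    (quotientMeasure (Subgroup.centralizer ({(Quotient.out (ConjClasses.mk (γ₁, a)) : G₁ × A).2} : Set A)) t₂ hC₂ νA)
    hne (quotientMeasure_ne_zero _ _ _ _) (quotientMeasure_ne_zero _ _ _ _)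
  have hone : ∫ x, descConj (Quotient.out (ConjClasses.mk (γ₁, a)) : G₁ × A).2
      (Subgroup.centralizer ({(Quotient.out (ConjClasses.mk (γ₁, a)) : G₁ × A).2} : Set A))
      (centralizer_comm (Quotient.out (ConjClasses.mk (γ₁, a)) : G₁ × A).2) (fun _ : A => (1 : ℂ)) x
      ∂quotientMeasure (Subgroup.centralizer ({(Quotient.out (ConjClasses.mk (γ₁, a)) : G₁ × A).2} : Set A)) t₂ hC₂ νA = 1 := by
    have h1 : descConj (Quotient.out (ConjClasses.mk (γ₁, a)) : G₁ × A).2 (Subgroup.centralizer ({(Quotient.out (ConjClasses.mk (γ₁, a)) : G₁ × A).2} : Set A))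
        (centralizer_comm (Quotient.out (ConjClasses.mk (γ₁, a)) : G₁ × A).2) (fun _ : A => (1 : ℂ)) = fun _ => (1 : ℂ) := by
      funext x
      induction x using QuotientGroup.induction_on with
      | H k => rfl
    rw [h1, integral_const, Measure.real, huniv₂, ENNReal.toReal_one, one_smul]
  refine ⟨((c : ℝ) : ℂ), Complex.ofReal_ne_zero.2 (NNReal.coe_ne_zero.2 hc0), fun f => ?_⟩
  have hf := hfac (fun p : G₁ × A => f p.1) f (fun _ => (1 : ℂ)) (fun _ _ => by simp only [MulEquiv.refl_apply, mul_one])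
  rw [hone, mul_one] at hf
  rw [classOrbitalIntegral_eq, orbitalIntegral_eq_integral_descConj, ← hmk₁,
    hm₁.classOrbitalIntegral_mk_eq_orbitalIntegral' hP₁ hP₁' t htcore f, orbitalIntegral_eq_integral_descConj]
  refine hf.trans ?_
  rw [NNReal.smul_def, Complex.real_smul]

end CompactFactorGeneral

end Literature.NumberTheory.Automorphic

end
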